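import Literature.AnabelianGeometry.SemiGraphs.PSCTwoComponentAffineFreeFactors
import Literature.AnabelianGeometry.SemiGraphs.ProSigmaLoneCuspDisjoint
import HarnessLib

/-!
# [CombGC] Prop. 1.5 (i) at two-component data POINTED ON BOTH SIDES (components with ONE marked point included)

Mochizuki, *A combinatorial version of the Grothendieck conjecture*, Tohoku Math. J. **59** (2007)
[CombGC], Prop. 1.5 (i) p. 12: an edge-like subgroup is cuspidal iff it is contained in precisely one
verticial subgroup, nodal iff in precisely two [cite: MochizukiCombGC2007, Prop 1.5(i) p.12].  abc-iut
FACT-LIST row F-0440 `PSCDatum.EdgeLikeIncidenceHolds` (schema over `Ω : PSCOrigin`, abc-iut-L3-t4;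
universal closure refuted, instance forms at genuine carriers the content).

PROOF-ONLY file (abc-iut-f-164 gen 4): gen 3's free-factor proof (`twoComponentAffine_freeFactor_rows`,
`s ≥ 2`, `r − s ≥ 2`) extended to the shape POINTED ON BOTH SIDES of gen 2
(`PSCTwoComponentAffinePointedOrigin.lean`: `1 ≤ s ≤ r − 1`, stability side conditions
`1 ≤ g₀ ∨ 2 ≤ r − s`, `1 ≤ g − g₀ ∨ 2 ≤ s`).  The node-loop basis `b'` of abc-iut-f-166 still carries
`Π_{v₀}`, `Π_{v₁}`, `Π_ν` and the cusps `c_j`, `j ∉ {0, s}`; the cusp `c_s` is a member of the Nielsen variant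
`b₄` when `s + 2 ≤ r` and `c_0` of `b₅` when `s ≥ 2` (gen 3); the two LONE cusps — `c_0` when `s = 1`, `c_s`
when `s = r − 1`, the single marked point of a component — are handled by the Heisenberg quotients of
`ProSigmaLoneCuspDisjoint.lean` (this gen).  The witness for `Π_{v₀} ≠ Π_{v₁}` is a handle of `C₀` or the cusp
`c_{s+1}`, by cases on the stability condition.

* `twoComponentPointed_incidence_rows` — `EdgeLikeIncidence ∧ Π_{v₀} ∩ Π_{v₁} = Π_ν ∧ Π_{v₀} ≠ Π_{v₁}` at
  every two-component datum pointed on both sides; `edgeLikeIncidence_of_twoComponentPointed` (F-0440);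
  `branchLink_of_twoComponentPointed` (the input of abc-iut-w4-d081's reduction of Prop. 1.5 (ii)).

Instance forms at data of the shape of genuine two-component curves: consistency evidence for the typed
schema, not the printed theorem for all pointed stable curves (cell FOUNDATIONS rows 13–14).  0 definitions;
nothing here takes a side on [IUTchIII] Cor. 3.12.
-/

noncomputable section

namespace Literature.AnabelianGeometry.SemiGraphs

namespace PSCDatum

open scoped Pointwise
open Literature.GroupTheory.CombinatorialGroupTheory
open Literature.GroupTheory.CombinatorialGroupTheory.PuncturedSurfaceGroup (a b c cuspInertia
  exists_freeGroupBasis_nodeLoop closure_firstSubsurface_eq_nodeLoopBasis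
  closure_secondSubsurface_eq_nodeLoopBasis exists_freeGroupBasis_nodeLoop_cusp
  exists_freeGroupBasis_nodeLoop_cusp_zero)
open SemiGraphOfAnabelioids (IsProSigmaCompletion infinite_cuspInertia_closure)
open SemiGraphOfAnabelioids.IsProSigmaCompletion (freeFactor_inf_conj_eq_bot_of_disjoint freeFactor_inf_eq
  infinite_freeFactor mem_freeFactor_of_inf_conj_ne_bot inf_conj_eq_bot_symm
  loneCuspZero_vertex_inf_conj_eq_bot loneCuspZero_nodeLoop_inf_conj_eq_bot
  loneCuspLast_vertex_inf_conj_eq_bot loneCuspLast_nodeLoop_inf_conj_eq_bot)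

variable {P : Type} [Group P] [TopologicalSpace P] [IsTopologicalGroup P]
variable [CompactSpace P] [T2Space P] [TotallyDisconnectedSpace P] {Sigma : Set ℕ} {g r : ℕ}

omit [TopologicalSpace P] [IsTopologicalGroup P] [CompactSpace P] [T2Space P]
  [TotallyDisconnectedSpace P] in
/-- An infinite subgroup is not trivial. [cite: MochizukiCombGC2007, Rmk 1.1.3 p.7] -/
private theorem ne_bot_of_infinite₅ {H : Subgroup P} (h : Infinite H) : H ≠ ⊥ := by
  rintro rfl
  exact h.not_finite inferInstance

omit [CompactSpace P] [T2Space P] [TotallyDisconnectedSpace P] in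
/-- `cl ι⟨x⟩ ≤ cl ι⟨S⟩` for `x ∈ ⟨S⟩`. [cite: MochizukiCombGC2007, Def 1.1(ii) p.6] -/
private theorem zpowers_closure_le₅ {Γ : Type*} [Group Γ] (ι : Γ →* P) {x : Γ} {S : Set Γ}
    (hx : x ∈ Subgroup.closure S) :
    ((Subgroup.zpowers x).map ι).topologicalClosure ≤ ((Subgroup.closure S).map ι).topologicalClosure :=
  Subgroup.topologicalClosure_mono (Subgroup.map_mono ((Subgroup.zpowers_le (g := x)).mpr hx))

/-- **[CombGC] Prop. 1.5 (i) at every two-component datum pointed on both sides, with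
`Π_{v₀} ∩ Π_{v₁} = Π_ν` and `Π_{v₀} ≠ Π_{v₁}`** (`1 ≤ s ≤ r − 1`; stability `1 ≤ g₀ ∨ 2 ≤ r − s`,
`1 ≤ g − g₀ ∨ 2 ≤ s`; `(g, r)` hyperbolic): free factors of the node-loop basis and its two Nielsen variants,
the lone cusps by Heisenberg quotients. [cite: MochizukiCombGC2007, Prop 1.5(i) p.12] -/
theorem twoComponentPointed_incidence_rows (hne : Sigma.Nonempty)
    (hprime : ∀ p ∈ Sigma, p.Prime) (ι : PuncturedSurfaceGroup g r →* P)
    (hι : IsProSigmaCompletion Sigma ι) (G : PSCDatum P) {g₀ s : ℕ} (hg₀ : g₀ ≤ g) (hs : 1 ≤ s)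
    (hsr : s + 1 ≤ r) (hst₀ : 1 ≤ g₀ ∨ 2 ≤ r - s) (hst₁ : 1 ≤ g - g₀ ∨ 2 ≤ s)
    (hhyp : PuncturedSurfaceGroup.IsHyperbolicType g r) (e : G.graph.C ≃ Fin r)
    (hC : ∀ c', G.cuspGp c' = ((cuspInertia (g := g) (e c')).map ι).topologicalClosure)
    (v₀ v₁ : G.graph.V) (hV : ∀ w, w = v₀ ∨ w = v₁) (ε : PuncturedSurfaceGroup g r)
    (hε : ε = ((List.finRange r).map fun j : Fin r =>
          if s ≤ (j : ℕ) then PuncturedSurfaceGroup.c (g := g) j else 1).prod *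
        ((List.finRange g).map fun i : Fin g => if (i : ℕ) < g₀ then
          PuncturedSurfaceGroup.a (r := r) i * PuncturedSurfaceGroup.b i *
            (PuncturedSurfaceGroup.a i)⁻¹ * (PuncturedSurfaceGroup.b i)⁻¹ else 1).prod)
    (hV₀ : G.vertGp v₀ = ((Subgroup.closure {x : PuncturedSurfaceGroup g r |
        (∃ i : Fin g, (i : ℕ) < g₀ ∧ (x = PuncturedSurfaceGroup.a i ∨ x = PuncturedSurfaceGroup.b i)) ∨
        ∃ j : Fin r, s ≤ (j : ℕ) ∧ x = PuncturedSurfaceGroup.c j}).map ι).topologicalClosure)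
    (hV₁ : G.vertGp v₁ = ((Subgroup.closure {x : PuncturedSurfaceGroup g r |
        (∃ i : Fin g, g₀ ≤ (i : ℕ) ∧ (x = PuncturedSurfaceGroup.a i ∨ x = PuncturedSurfaceGroup.b i)) ∨
        (∃ j : Fin r, (j : ℕ) < s ∧ x = PuncturedSurfaceGroup.c j) ∨ x = ε}).map ι).topologicalClosure)
    (n₀ : G.graph.N) (hN : ∀ n, n = n₀)
    (hE : G.nodeGp n₀ = ((Subgroup.zpowers ε).map ι).topologicalClosure) :
    G.EdgeLikeIncidence ∧ G.vertGp v₀ ⊓ G.vertGp v₁ = G.nodeGp n₀ ∧ G.vertGp v₀ ≠ G.vertGp v₁ := by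
  classical
  obtain ⟨r', rfl⟩ : ∃ r', r = r' + 1 := ⟨r - 1, by omega⟩
  have hp : ∃ p ∈ Sigma, p.Prime := hne.imp fun p hp => ⟨hp, hprime p hp⟩
  have hs1' : s - 1 < r' := by omega
  have hsr₁ : s < r' + 1 := by omega
  have hr0 : 0 < r' := by omega
  have hr0₁ : 0 < r' + 1 := by omega
  -- the node-loop basis
  obtain ⟨b', ha', hb', hc', hk'⟩ := exists_freeGroupBasis_nodeLoop g r' g₀ s (by omega) (by omega) ε hε
  have hk : ∀ h : s - 1 < r', b' (Sum.inr ⟨s - 1, h⟩) = ε := fun _ => hk'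
  -- index sets and the node slot
  set S₀ : Set ((Fin g × Bool) ⊕ Fin r') :=
    {x | Sum.elim (fun p : Fin g × Bool => (p.1 : ℕ) < g₀) (fun j : Fin r' => s ≤ (j : ℕ) + 1) x} with hS₀
  set T₁ : Set ((Fin g × Bool) ⊕ Fin r') :=
    {x | Sum.elim (fun p : Fin g × Bool => g₀ ≤ (p.1 : ℕ)) (fun j : Fin r' => (j : ℕ) + 1 ≤ s) x} with hT₁
  have hSl : ∀ p : Fin g × Bool, (Sum.inl p : (Fin g × Bool) ⊕ Fin r') ∈ S₀ ↔ (p.1 : ℕ) < g₀ :=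
    fun _ => Iff.rfl
  have hSr : ∀ j : Fin r', (Sum.inr j : (Fin g × Bool) ⊕ Fin r') ∈ S₀ ↔ s ≤ (j : ℕ) + 1 := fun _ => Iff.rfl
  have hTl : ∀ p : Fin g × Bool, (Sum.inl p : (Fin g × Bool) ⊕ Fin r') ∈ T₁ ↔ g₀ ≤ (p.1 : ℕ) :=
    fun _ => Iff.rfl
  have hTr : ∀ j : Fin r', (Sum.inr j : (Fin g × Bool) ⊕ Fin r') ∈ T₁ ↔ (j : ℕ) + 1 ≤ s := fun _ => Iff.rfl
  set σ : (Fin g × Bool) ⊕ Fin r' := Sum.inr ⟨s - 1, hs1'⟩ with hσ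
  have hσS : σ ∈ S₀ := (hSr _).mpr (by simp only; omega)
  have hσT : σ ∈ T₁ := (hTr _).mpr (by simp only; omega)
  have hST : S₀ ∩ T₁ = {σ} := by
    ext x
    constructor
    · rintro ⟨h0, h1⟩
      rcases x with ⟨i, bb⟩ | j
      · exact absurd (lt_of_lt_of_le ((hSl _).mp h0) ((hTl _).mp h1)) (lt_irrefl _)
      · have h0' := (hSr _).mp h0
        have h1' := (hTr _).mp h1
        rw [Set.mem_singleton_iff, hσ]
        exact congrArg Sum.inr (Fin.ext (by simp only; omega))
    · rintro rfl
      exact ⟨hσS, hσT⟩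
  -- the three non-cuspidal representatives as sub-basis closures of `b'`
  have hA₀ : G.vertGp v₀ = ((Subgroup.closure (b' '' S₀)).map ι).topologicalClosure := by
    rw [hV₀, closure_firstSubsurface_eq_nodeLoopBasis hε ha' hb' hc' hk (by omega) (by omega)]
  have hA₁ : G.vertGp v₁ = ((Subgroup.closure (b' '' T₁)).map ι).topologicalClosure := by
    rw [hV₁, closure_secondSubsurface_eq_nodeLoopBasis hε ha' hb' hc' hk (by omega) (by omega)]
  have hN₀ : G.nodeGp n₀ = ((Subgroup.closure (b' '' {σ})).map ι).topologicalClosure := by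
    rw [hE, closure_image_singleton, hσ, hk hs1']
  have hK : ∀ j : Fin (r' + 1), ((cuspInertia (g := g) j).map ι).topologicalClosure =
      ((Subgroup.zpowers (c (g := g) j)).map ι).topologicalClosure := fun _ => rfl
  have hKb' : ∀ (j : Fin (r' + 1)) (hj0 : (j : ℕ) ≠ 0), (j : ℕ) ≠ s →
      Subgroup.zpowers (c (g := g) j) =
        Subgroup.closure (b' '' {Sum.inr (j.pred (fun h => hj0 (by rw [h]; rfl)))}) := by
    intro j hj0 hjs
    rw [closure_image_singleton, hc' _ (by rw [Fin.val_pred]; omega), Fin.succ_pred]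
  -- (a) `Π_{v₀} ∩ Π_{v₁} = Π_ν`
  have hinf : G.vertGp v₀ ⊓ G.vertGp v₁ = G.nodeGp n₀ := by
    rw [hA₀, hA₁, hN₀, freeFactor_inf_eq b' S₀ T₁ hι, hST]
  -- (b) `Π_{v₀} ≠ Π_{v₁}`: a member of `S₀ ∖ T₁` (a handle of `C₀`, or the cusp `c_{s+1}`)
  have hvne : G.vertGp v₀ ≠ G.vertGp v₁ := by
    obtain ⟨θ, hθS, hθT⟩ : ∃ θ, θ ∈ S₀ ∧ θ ∉ T₁ := by
      rcases hst₀ with h | h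
      · exact ⟨Sum.inl (⟨0, by omega⟩, false), (hSl _).mpr (by simp only; omega),
          fun h' => by have := (hTl _).mp h'; simp only at this; omega⟩
      · exact ⟨Sum.inr ⟨s, by omega⟩, (hSr _).mpr (by simp only; omega),
          fun h' => by have := (hTr _).mp h'; simp only at this; omega⟩
    intro h
    have h0 := freeFactor_inf_conj_eq_bot_of_disjoint b' {θ} T₁ (Set.disjoint_singleton_left.mpr hθT) hι 1
    rw [map_one, one_smul] at h0
    have hle : ((Subgroup.closure (b' '' {θ})).map ι).topologicalClosure ≤
        ((Subgroup.closure (b' '' T₁)).map ι).topologicalClosure := by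
      rw [← hA₁, ← h, hA₀]
      exact Subgroup.topologicalClosure_mono (Subgroup.map_mono (Subgroup.closure_mono
        (Set.image_mono (Set.singleton_subset_iff.mpr hθS))))
    exact ne_bot_of_infinite₅ (infinite_freeFactor b' {θ} ⟨θ, rfl⟩ hι hp)
      (le_bot_iff.mp (h0 ▸ le_inf le_rfl hle))
  -- (c) node vs cusps
  have hNC : ∀ (j : Fin (r' + 1)) (x : P),
      G.nodeGp n₀ ⊓ ConjAct.toConjAct x • ((cuspInertia (g := g) j).map ι).topologicalClosure = ⊥ := by
    intro j x
    rw [hK]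
    by_cases hj0 : (j : ℕ) = 0
    · have hj : j = ⟨0, hr0₁⟩ := Fin.ext hj0
      by_cases hs2 : 2 ≤ s
      · -- `c_0` is a member of the Nielsen variant `b₅`
        obtain ⟨b₅, hb₅κ, hb₅⟩ := exists_freeGroupBasis_nodeLoop_cusp_zero hε ha' hb' hc' hk hs2 (by omega)
        have hσκ : σ ≠ Sum.inr ⟨0, hr0⟩ := by
          simp only [hσ, Ne, Sum.inr.injEq, Fin.mk.injEq]; omega
        have hσb₅ : Subgroup.closure (b' '' {σ}) = Subgroup.closure (b₅ '' {σ}) :=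
          closure_image_congr fun x hx =>
            (hb₅ x (fun h => hσκ ((Set.mem_singleton_iff.mp hx).symm.trans h))).symm
        have hKκ : Subgroup.zpowers (c (g := g) ⟨0, hr0₁⟩) = Subgroup.closure (b₅ '' {Sum.inr ⟨0, hr0⟩}) := by
          rw [closure_image_singleton, hb₅κ]
        rw [hj, hN₀, hKκ, hσb₅]
        exact freeFactor_inf_conj_eq_bot_of_disjoint b₅ {σ} _ (Set.disjoint_singleton.mpr hσκ) hι x
      · -- `s = 1`: the lone cusp `c_0` of `C₁`, by a Heisenberg quotient on a handle of `C₁`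
        have hs1 : s = 1 := by omega
        subst hs1
        have hg₁ : g₀ < g := by omega
        rw [hj, hE]
        exact loneCuspZero_nodeLoop_inf_conj_eq_bot hι ⟨g₀, hg₁⟩ le_rfl hr0₁ ε hε x
    · by_cases hjs : (j : ℕ) = s
      · have hj : j = ⟨s, hsr₁⟩ := Fin.ext hjs
        by_cases hs' : s < r'
        · -- `c_s` is a member of the Nielsen variant `b₄`
          obtain ⟨b₄, hb₄τ, hb₄⟩ := exists_freeGroupBasis_nodeLoop_cusp hε ha' hb' hc' hk (by omega) (by omega)
          have hστ : σ ≠ Sum.inr ⟨s, hs'⟩ := by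
            simp only [hσ, Ne, Sum.inr.injEq, Fin.mk.injEq]; omega
          have hσb₄ : Subgroup.closure (b' '' {σ}) = Subgroup.closure (b₄ '' {σ}) :=
            closure_image_congr fun x hx =>
              (hb₄ x (fun h => hστ ((Set.mem_singleton_iff.mp hx).symm.trans h))).symm
          have hKτ : Subgroup.zpowers (c (g := g) ⟨s, hsr₁⟩) = Subgroup.closure (b₄ '' {Sum.inr ⟨s, hs'⟩}) := by
            rw [closure_image_singleton, hb₄τ]
          rw [hj, hN₀, hKτ, hσb₄]
          exact freeFactor_inf_conj_eq_bot_of_disjoint b₄ {σ} _ (Set.disjoint_singleton.mpr hστ) hι x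
        · -- `s = r'`: the lone cusp `c_{r'}` of `C₀`, by a Heisenberg quotient on a handle of `C₀`
          have hsr' : s = r' := by omega
          subst hsr'
          have hg₀1 : 0 < g₀ := by omega
          rw [hj, hE]
          have h := loneCuspLast_nodeLoop_inf_conj_eq_bot hι (⟨0, by omega⟩ : Fin g) hg₀1 hr0₁ ε
            (by simpa only [Nat.add_sub_cancel] using hε) x
          simpa only [Nat.add_sub_cancel] using h
      · rw [hN₀, hKb' j hj0 hjs]
        refine freeFactor_inf_conj_eq_bot_of_disjoint b' {σ} _ (Set.disjoint_singleton.mpr ?_) hι x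
        rw [hσ, Ne, Sum.inr.injEq, Fin.ext_iff, Fin.val_pred]
        simp only
        omega
  -- (d) cusps of `C₀` vs `Π_{v₁}`, cusps of `C₁` vs `Π_{v₀}`
  have hCV₁ : ∀ (j : Fin (r' + 1)), s ≤ (j : ℕ) → ∀ x : P,
      ((cuspInertia (g := g) j).map ι).topologicalClosure ⊓ ConjAct.toConjAct x • G.vertGp v₁ = ⊥ := by
    intro j hj x
    rw [hK]
    by_cases hjs : (j : ℕ) = s
    · have hj' : j = ⟨s, hsr₁⟩ := Fin.ext hjs
      by_cases hs' : s < r'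
      · obtain ⟨b₄, hb₄τ, hb₄⟩ := exists_freeGroupBasis_nodeLoop_cusp hε ha' hb' hc' hk (by omega) (by omega)
        have hτT : (Sum.inr ⟨s, hs'⟩ : (Fin g × Bool) ⊕ Fin r') ∉ T₁ := fun h => by
          have := (hTr _).mp h; simp only at this; omega
        have hT₁b₄ : Subgroup.closure (b' '' T₁) = Subgroup.closure (b₄ '' T₁) :=
          closure_image_congr fun x hx => (hb₄ x (fun h => hτT (h ▸ hx))).symm
        have hKτ : Subgroup.zpowers (c (g := g) ⟨s, hsr₁⟩) = Subgroup.closure (b₄ '' {Sum.inr ⟨s, hs'⟩}) := by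
          rw [closure_image_singleton, hb₄τ]
        rw [hA₁, hj', hKτ, hT₁b₄]
        exact freeFactor_inf_conj_eq_bot_of_disjoint b₄ _ T₁ (Set.disjoint_singleton_left.mpr hτT) hι x
      · -- lone cusp of `C₀`
        have hsr' : s = r' := by omega
        subst hsr'
        have hg₀1 : 0 < g₀ := by omega
        rw [hj', hV₁]
        refine inf_conj_eq_bot_symm (fun y => ?_) x
        have h := loneCuspLast_vertex_inf_conj_eq_bot hι (⟨0, by omega⟩ : Fin g) hg₀1 hr0₁ ε
          (by simpa only [Nat.add_sub_cancel] using hε) y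
        simpa only [Nat.add_sub_cancel] using h
    · rw [hA₁, hKb' j (by omega) hjs]
      refine freeFactor_inf_conj_eq_bot_of_disjoint b' _ T₁ (Set.disjoint_singleton_left.mpr ?_) hι x
      rw [hTr, Fin.val_pred]
      omega
  have hCV₀ : ∀ (j : Fin (r' + 1)), (j : ℕ) < s → ∀ x : P,
      ((cuspInertia (g := g) j).map ι).topologicalClosure ⊓ ConjAct.toConjAct x • G.vertGp v₀ = ⊥ := by
    intro j hj x
    rw [hK]
    by_cases hj0 : (j : ℕ) = 0
    · have hj' : j = ⟨0, hr0₁⟩ := Fin.ext hj0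
      by_cases hs2 : 2 ≤ s
      · obtain ⟨b₅, hb₅κ, hb₅⟩ := exists_freeGroupBasis_nodeLoop_cusp_zero hε ha' hb' hc' hk hs2 (by omega)
        have hκS : (Sum.inr ⟨0, hr0⟩ : (Fin g × Bool) ⊕ Fin r') ∉ S₀ := fun h => by
          have := (hSr _).mp h; simp only at this; omega
        have hS₀b₅ : Subgroup.closure (b' '' S₀) = Subgroup.closure (b₅ '' S₀) :=
          closure_image_congr fun x hx => (hb₅ x (fun h => hκS (h ▸ hx))).symm
        have hKκ : Subgroup.zpowers (c (g := g) ⟨0, hr0₁⟩) = Subgroup.closure (b₅ '' {Sum.inr ⟨0, hr0⟩}) := by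
          rw [closure_image_singleton, hb₅κ]
        rw [hA₀, hj', hKκ, hS₀b₅]
        exact freeFactor_inf_conj_eq_bot_of_disjoint b₅ _ S₀ (Set.disjoint_singleton_left.mpr hκS) hι x
      · -- lone cusp of `C₁`
        have hs1 : s = 1 := by omega
        subst hs1
        have hg₁ : g₀ < g := by omega
        rw [hj', hV₀]
        exact inf_conj_eq_bot_symm (fun y => loneCuspZero_vertex_inf_conj_eq_bot hι ⟨g₀, hg₁⟩ le_rfl hr0₁ y) x
    · rw [hA₀, hKb' j hj0 (by omega)]
      refine freeFactor_inf_conj_eq_bot_of_disjoint b' _ S₀ (Set.disjoint_singleton_left.mpr ?_) hι x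
      rw [hSr, Fin.val_pred]
      omega
  -- (e) Prop. 1.5 (i)
  have hinc : G.EdgeLikeIncidence := by
    refine G.edgeLikeIncidence_of (fun v x h => ?_) (fun n => ?_) (fun c' => ?_) (fun n c' x => ?_)
      (fun n => ⟨v₀, v₁, ?_, ?_, hvne, fun w hw₀ hw₁ x => ?_⟩) (fun c' => ?_)
    · rcases hV v with rfl | rfl
      · rw [hA₀] at h ⊢; exact mem_freeFactor_of_inf_conj_ne_bot b' _ hι h
      · rw [hA₁] at h ⊢; exact mem_freeFactor_of_inf_conj_ne_bot b' _ hι h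
    · rw [hN n, hN₀]; exact ne_bot_of_infinite₅ (infinite_freeFactor b' _ ⟨σ, rfl⟩ hι hp)
    · rw [hC]; exact ne_bot_of_infinite₅ (infinite_cuspInertia_closure hne hprime hhyp ι hι (e c'))
    · rw [hN n, hC]; exact hNC (e c') x
    · rw [hN n, ← hinf]; exact inf_le_left
    · rw [hN n, ← hinf]; exact inf_le_right
    · rcases hV w with rfl | rfl
      · exact absurd rfl hw₀
      · exact absurd rfl hw₁
    · rw [hC]
      by_cases hj : s ≤ ((e c' : Fin (r' + 1)) : ℕ)
      · refine ⟨v₀, ?_, fun w hw x => ?_⟩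
        · rw [hK, hV₀]
          exact zpowers_closure_le₅ ι (Subgroup.subset_closure (Or.inr ⟨e c', hj, rfl⟩))
        · rcases hV w with rfl | rfl
          · exact absurd rfl hw
          · exact hCV₁ (e c') hj x
      · refine ⟨v₁, ?_, fun w hw x => ?_⟩
        · rw [hK, hV₁]
          exact zpowers_closure_le₅ ι (Subgroup.subset_closure (Or.inr (Or.inl ⟨e c', by omega, rfl⟩)))
        · rcases hV w with rfl | rfl
          · exact hCV₀ (e c') (by omega) x
          · exact absurd rfl hw
  exact ⟨hinc, hinf, hvne⟩

/-- **F-0440 / [CombGC] Prop. 1.5 (i) at every two-component datum pointed on both sides** (components with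
ONE marked point included): an edge-like subgroup is cuspidal iff it lies in exactly one verticial subgroup,
the node's in exactly two. [cite: MochizukiCombGC2007, Prop 1.5(i) p.12] -/
theorem edgeLikeIncidence_of_twoComponentPointed (hne : Sigma.Nonempty)
    (hprime : ∀ p ∈ Sigma, p.Prime) (ι : PuncturedSurfaceGroup g r →* P)
    (hι : IsProSigmaCompletion Sigma ι) (G : PSCDatum P) {g₀ s : ℕ} (hg₀ : g₀ ≤ g) (hs : 1 ≤ s)
    (hsr : s + 1 ≤ r) (hst₀ : 1 ≤ g₀ ∨ 2 ≤ r - s) (hst₁ : 1 ≤ g - g₀ ∨ 2 ≤ s)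
    (hhyp : PuncturedSurfaceGroup.IsHyperbolicType g r) (e : G.graph.C ≃ Fin r)
    (hC : ∀ c', G.cuspGp c' = ((cuspInertia (g := g) (e c')).map ι).topologicalClosure)
    (v₀ v₁ : G.graph.V) (hV : ∀ w, w = v₀ ∨ w = v₁) (ε : PuncturedSurfaceGroup g r)
    (hε : ε = ((List.finRange r).map fun j : Fin r =>
          if s ≤ (j : ℕ) then PuncturedSurfaceGroup.c (g := g) j else 1).prod *
        ((List.finRange g).map fun i : Fin g => if (i : ℕ) < g₀ then
          PuncturedSurfaceGroup.a (r := r) i * PuncturedSurfaceGroup.b i *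
            (PuncturedSurfaceGroup.a i)⁻¹ * (PuncturedSurfaceGroup.b i)⁻¹ else 1).prod)
    (hV₀ : G.vertGp v₀ = ((Subgroup.closure {x : PuncturedSurfaceGroup g r |
        (∃ i : Fin g, (i : ℕ) < g₀ ∧ (x = PuncturedSurfaceGroup.a i ∨ x = PuncturedSurfaceGroup.b i)) ∨
        ∃ j : Fin r, s ≤ (j : ℕ) ∧ x = PuncturedSurfaceGroup.c j}).map ι).topologicalClosure)
    (hV₁ : G.vertGp v₁ = ((Subgroup.closure {x : PuncturedSurfaceGroup g r |
        (∃ i : Fin g, g₀ ≤ (i : ℕ) ∧ (x = PuncturedSurfaceGroup.a i ∨ x = PuncturedSurfaceGroup.b i)) ∨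
        (∃ j : Fin r, (j : ℕ) < s ∧ x = PuncturedSurfaceGroup.c j) ∨ x = ε}).map ι).topologicalClosure)
    (n₀ : G.graph.N) (hN : ∀ n, n = n₀)
    (hE : G.nodeGp n₀ = ((Subgroup.zpowers ε).map ι).topologicalClosure) :
    G.EdgeLikeIncidence :=
  (G.twoComponentPointed_incidence_rows hne hprime ι hι hg₀ hs hsr hst₀ hst₁ hhyp e hC v₀ v₁ hV ε hε hV₀ hV₁
    n₀ hN hE).1

/-- **The branch link at every two-component datum pointed on both sides** (with `nodeEnds` recorded): both
branches of the node land (trivial conjugators) in the DISTINCT verticial subgroups `Π_{v₀}`, `Π_{v₁}` — the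
input of abc-iut-w4-d081's reduction of [CombGC] Prop. 1.5 (ii). [cite: MochizukiCombGC2007, Prop 1.5(ii) p.13] -/
theorem branchLink_of_twoComponentPointed (hne : Sigma.Nonempty)
    (hprime : ∀ p ∈ Sigma, p.Prime) (ι : PuncturedSurfaceGroup g r →* P)
    (hι : IsProSigmaCompletion Sigma ι) (G : PSCDatum P) {g₀ s : ℕ} (hg₀ : g₀ ≤ g) (hs : 1 ≤ s)
    (hsr : s + 1 ≤ r) (hst₀ : 1 ≤ g₀ ∨ 2 ≤ r - s) (hst₁ : 1 ≤ g - g₀ ∨ 2 ≤ s)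
    (hhyp : PuncturedSurfaceGroup.IsHyperbolicType g r) (e : G.graph.C ≃ Fin r)
    (hC : ∀ c', G.cuspGp c' = ((cuspInertia (g := g) (e c')).map ι).topologicalClosure)
    (v₀ v₁ : G.graph.V) (hV : ∀ w, w = v₀ ∨ w = v₁) (ε : PuncturedSurfaceGroup g r)
    (hε : ε = ((List.finRange r).map fun j : Fin r =>
          if s ≤ (j : ℕ) then PuncturedSurfaceGroup.c (g := g) j else 1).prod *
        ((List.finRange g).map fun i : Fin g => if (i : ℕ) < g₀ then
          PuncturedSurfaceGroup.a (r := r) i * PuncturedSurfaceGroup.b i *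
            (PuncturedSurfaceGroup.a i)⁻¹ * (PuncturedSurfaceGroup.b i)⁻¹ else 1).prod)
    (hV₀ : G.vertGp v₀ = ((Subgroup.closure {x : PuncturedSurfaceGroup g r |
        (∃ i : Fin g, (i : ℕ) < g₀ ∧ (x = PuncturedSurfaceGroup.a i ∨ x = PuncturedSurfaceGroup.b i)) ∨
        ∃ j : Fin r, s ≤ (j : ℕ) ∧ x = PuncturedSurfaceGroup.c j}).map ι).topologicalClosure)
    (hV₁ : G.vertGp v₁ = ((Subgroup.closure {x : PuncturedSurfaceGroup g r |
        (∃ i : Fin g, g₀ ≤ (i : ℕ) ∧ (x = PuncturedSurfaceGroup.a i ∨ x = PuncturedSurfaceGroup.b i)) ∨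
        (∃ j : Fin r, (j : ℕ) < s ∧ x = PuncturedSurfaceGroup.c j) ∨ x = ε}).map ι).topologicalClosure)
    (n₀ : G.graph.N) (hN : ∀ n, n = n₀)
    (hE : G.nodeGp n₀ = ((Subgroup.zpowers ε).map ι).topologicalClosure)
    (hends : ∀ n, G.graph.nodeEnds n = s(v₀, v₁)) :
    ∀ n : G.graph.N, ∃ (w₁ w₂ : G.graph.V) (γ₁ γ₂ : ConjAct P),
      G.graph.nodeEnds n = s(w₁, w₂) ∧ γ₁ • G.nodeGp n ≤ G.vertGp w₁ ∧
        γ₂ • G.nodeGp n ≤ G.vertGp w₂ ∧ γ₁⁻¹ • G.vertGp w₁ ≠ γ₂⁻¹ • G.vertGp w₂ := by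
  obtain ⟨-, hinf, hvne⟩ := G.twoComponentPointed_incidence_rows hne hprime ι hι hg₀ hs hsr hst₀ hst₁ hhyp e hC
    v₀ v₁ hV ε hε hV₀ hV₁ n₀ hN hE
  intro n
  refine ⟨v₀, v₁, 1, 1, hends n, ?_, ?_, ?_⟩
  · rw [one_smul, hN n, ← hinf]; exact inf_le_left
  · rw [one_smul, hN n, ← hinf]; exact inf_le_right
  · rwa [inv_one, one_smul, one_smul]

end PSCDatum

end Literature.AnabelianGeometry.SemiGraphs

end
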